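import Mathlib.Analysis.Normed.Unbundled.SpectralNorm
import Mathlib.Topology.Algebra.Valued.NormedValued
import Mathlib.FieldTheory.KrullTopology
import Mathlib.FieldTheory.Galois.Infinite
import Summits.ABC.IUTFork.LanaLocalUnits
import Summits.ABC.IUTFork.LanaLogShell
import HarnessLib

/-!
# L-LANA objects II ter: the reference local data at ANY nonarchimedean place, CONSTRUCTED (`G_{K_v} ↷ K̄_v` via the spectral norm)

Record-only file (D-0012) of the abc-iut cell (seat abc-iut-c312-4, L-LANA level, LLANA-SPEC N3/N4 instance,
general nonarchimedean place); TAKES NO SIDE on [IUTchIII] Cor. 3.12. `LanaPadicGalois.lean` discharged the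
hypothesis `IsValPreserving` of `LanaLocalUnits` at `K_v = ℚ_p` using Mathlib's packaged `PadicAlgCl`. This
file does it for EVERY complete nontrivially-normed ultrametric field `K_v` (e.g. the completions
`v.adicCompletion F` of a number field, to which `LanaDegrees` attaches the degrees), from Mathlib's
spectral-norm theory:

* `AlgCl K_v` := `K̄_v` = `AlgebraicClosure K_v` as a type synonym carrying the SPECTRAL norm (Mathlib
  `spectralNorm.normedField`: multiplicative because `K_v` is complete and ultrametric), the induced
  `Valued … ℝ≥0`, and `G_v := Gal(K̄_v/K_v) = AlgCl K_v ≃ₐ[K_v] AlgCl K_v` with the Krull topology.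
* PROVED: `AlgCl.norm_galois` (`‖σ x‖ = ‖x‖`: LANA §3.5 "`G_v` … the group of suitable automorphisms of the
  field `K̄_v`" acts isometrically — Mathlib `spectralNorm_eq_of_equiv`); the instance `IsValPreserving`;
  `AlgCl.continuousSMul_galois` (Krull × norm topology: open stabilisers + isometries).
* Hence at every such place, with no hypothesis: `G_v ↷ O^{×μ}_v` (`AlgCl.UnitsModTorsion`), `I^κ_H`, the
  `(MF)` log-shell; and, in characteristic zero, §3.9's "version without an overline": the `G_v`-invariants
  of `K̄_v` are `K_v` (`AlgCl.fixed_iff_mem_range`, infinite Galois theory) and `(O^×_{K̄_v})^{G_v}` = the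
  norm-one elements coming from `K_v` (`AlgCl.mem_unitInv_iff`).

[cite: LANA2026Report, §3.5 p. 19, §3.6 p. 20, §3.9 p. 21, Def. 3.9.1 p. 22] NOT here: `Π_v` (L3-t2/L4-t1),
archimedean places, any judgement.
-/

noncomputable section

namespace Summit.ABC
namespace IUTFork

open scoped NNReal

/-- `K̄_v`: an algebraic closure of the local field `K_v`, as a type synonym that will carry the spectral
norm (so that no instance is put on Mathlib's `AlgebraicClosure` itself). [cite: LANA2026Report, §3.5 p. 19] -/
def AlgCl (K₀ : Type) [Field K₀] : Type := AlgebraicClosure K₀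

namespace AlgCl

section FieldStructure

variable (K₀ : Type) [Field K₀]

/-- field structure of `K̄_v` (Mathlib's). [folklore] -/
instance instField : Field (AlgCl K₀) := inferInstanceAs (Field (AlgebraicClosure K₀))
/-- `K̄_v` is a `K_v`-algebra. [folklore] -/
instance instAlgebra : Algebra K₀ (AlgCl K₀) := inferInstanceAs (Algebra K₀ (AlgebraicClosure K₀))
/-- `K̄_v` is an algebraic closure of `K_v`. [folklore] -/
instance instIsAlgClosure : IsAlgClosure K₀ (AlgCl K₀) :=
  inferInstanceAs (IsAlgClosure K₀ (AlgebraicClosure K₀))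
/-- `K̄_v/K_v` is algebraic. [folklore] -/
instance instIsAlgebraic : Algebra.IsAlgebraic K₀ (AlgCl K₀) :=
  inferInstanceAs (Algebra.IsAlgebraic K₀ (AlgebraicClosure K₀))
/-- `K̄_v/K_v` is integral. [folklore] -/
instance instIsIntegral : Algebra.IsIntegral K₀ (AlgCl K₀) :=
  inferInstanceAs (Algebra.IsIntegral K₀ (AlgebraicClosure K₀))

end FieldStructure

section Norm

variable (K₀ : Type) [NontriviallyNormedField K₀] [CompleteSpace K₀] [IsUltrametricDist K₀]

/-- **`K̄_v` with the spectral norm** (the unique extension of `| · |_{K_v}`; multiplicative because `K_v` is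
complete and ultrametric — Mathlib `spectralNorm.normedField`). [cite: LANA2026Report, §0.4 (b) p. 8] -/
instance instNormedField : NormedField (AlgCl K₀) := spectralNorm.normedField K₀ (AlgCl K₀)

/-- The norm of `K̄_v` IS the spectral norm. [folklore] -/
theorem norm_eq_spectralNorm (x : AlgCl K₀) : ‖x‖ = spectralNorm K₀ (AlgCl K₀) x := rfl

/-- The spectral norm is nonarchimedean, so `K̄_v` is ultrametric. [folklore] -/
instance instIsUltrametricDist : IsUltrametricDist (AlgCl K₀) :=
  IsUltrametricDist.isUltrametricDist_of_forall_norm_add_le_max_norm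
    (isNonarchimedean_spectralNorm (K := K₀) (L := AlgCl K₀))

/-- `K̄_v` as a valued field, `|x| := ‖x‖₊ ∈ ℝ≥0`. [cite: LANA2026Report, §0.4 (b) p. 8] -/
instance instValued : Valued (AlgCl K₀) ℝ≥0 := NormedField.toValued

/-- The valuation is the norm. [folklore] -/
theorem valuation_coe (x : AlgCl K₀) : ((Valued.v x : ℝ≥0) : ℝ) = ‖x‖ := rfl

/-- `G_v := Gal(K̄_v/K_v)` (Krull topology; acts on `K̄_v` by `K_v`-algebra automorphisms).
[cite: LANA2026Report, §3.5 p. 19] -/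
abbrev Gal : Type := AlgCl K₀ ≃ₐ[K₀] AlgCl K₀

/-- The valuation `| · |` of `K̄_v` as a `Valuation`. [cite: LANA2026Report, §0.4 (b) p. 8] -/
abbrev val : Valuation (AlgCl K₀) ℝ≥0 := Valued.v

/-- **`G_v` acts by isometries**: `‖σ x‖ = ‖x‖`. [cite: LANA2026Report, §3.5 p. 19] -/
theorem norm_galois (σ : Gal K₀) (x : AlgCl K₀) : ‖σ x‖ = ‖x‖ := by
  rw [norm_eq_spectralNorm, norm_eq_spectralNorm, ← spectralNorm_eq_of_equiv]

/-- **`IsValPreserving` DISCHARGED at every nonarchimedean place.** [cite: LANA2026Report, §3.5 p. 19] -/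
instance isValPreserving : IsValPreserving (val K₀) (Gal K₀) where
  val_smul σ x := by
    apply NNReal.coe_injective
    rw [val, valuation_coe, valuation_coe, AlgEquiv.smul_def, norm_galois]

/-- **Continuity of `G_v × K̄_v → K̄_v`** (Krull × norm): open stabilisers and isometries.
[cite: LANA2026Report, Def. 3.7.1 p. 20] -/
instance continuousSMul_galois : ContinuousSMul (Gal K₀) (AlgCl K₀) where
  continuous_smul := by
    rw [continuous_iff_continuousAt]
    rintro ⟨σ₀, x₀⟩
    rw [ContinuousAt, Metric.tendsto_nhds]
    intro ε hε
    have hU : {σ : Gal K₀ | σ₀⁻¹ * σ ∈ MulAction.stabilizer (Gal K₀) x₀} ∈ nhds σ₀ := by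
      refine IsOpen.mem_nhds ?_ ?_
      · exact (stabilizer_isOpen_of_isIntegral (K := K₀) x₀).preimage (continuous_const_mul σ₀⁻¹)
      · simp [MulAction.mem_stabilizer_iff]
    have hV : Metric.ball x₀ ε ∈ nhds x₀ := Metric.ball_mem_nhds x₀ hε
    filter_upwards [prod_mem_nhds hU hV]
    rintro ⟨σ, x⟩ ⟨hσ, hx⟩
    simp only [Set.mem_setOf_eq, MulAction.mem_stabilizer_iff, AlgEquiv.smul_def] at hσ
    rw [Metric.mem_ball, dist_eq_norm] at hx
    rw [dist_eq_norm, AlgEquiv.smul_def, AlgEquiv.smul_def]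
    have h1 : σ x - σ₀ x₀ = σ₀ ((σ₀⁻¹ * σ) (x - x₀)) := by
      rw [map_sub, AlgEquiv.mul_apply, hσ, map_sub, ← AlgEquiv.mul_apply, mul_inv_cancel, AlgEquiv.one_apply]
    rw [h1, norm_galois, norm_galois]
    exact hx

/-! ### The reference objects at the place, with no hypothesis left -/

/-- **`G_v ↷ O^{×μ}_v = O^×_{K̄_v}/O^μ`** (§3.6) at the place. [cite: LANA2026Report, §3.6 p. 20] -/
abbrev UnitsModTorsion : Type := IUTFork.UnitsModTorsion (val K₀)

/-- The `G_v`-action on `O^{×μ}_v` is an instance (no hypothesis). [cite: LANA2026Report, §3.6 p. 20] -/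
example : MulDistribMulAction (Gal K₀) (UnitsModTorsion K₀) := inferInstance

/-- **`I^κ_H`** (Def. 3.9.1) at the place. [cite: LANA2026Report, Def. 3.9.1 p. 22] -/
abbrev kummer (H : Subgroup (Gal K₀)) : Subgroup (UnitsModTorsion K₀) := kummerStructure (val K₀) (Gal K₀) H

/-- **The `(MF)` log-shell** (§5.1 (c)) at a place of residue characteristic `p`.
[cite: LANA2026Report, §5.1 (c) p. 27] -/
abbrev logShell (p : ℕ) : Subgroup (UnitsModTorsion K₀) := logShellMF (val K₀) (Gal K₀) p

end Norm

/-! ### §3.9 in characteristic zero: the invariants are the base -/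

section CharZero

variable (K₀ : Type) [NontriviallyNormedField K₀] [CompleteSpace K₀] [IsUltrametricDist K₀] [CharZero K₀]

/-- In characteristic zero `K̄_v/K_v` is Galois. [folklore] -/
instance isGalois : IsGalois K₀ (AlgCl K₀) := {}

omit [CompleteSpace K₀] [IsUltrametricDist K₀] in
/-- **§3.9 p. 21** ("defined by its `G_v`-invariant portion"): the `G_v`-invariants of `K̄_v` are `K_v`.
[cite: LANA2026Report, §3.9 p. 21] -/
theorem fixed_iff_mem_range (x : AlgCl K₀) :
    (∀ σ : Gal K₀, σ • x = x) ↔ x ∈ Set.range (algebraMap K₀ (AlgCl K₀)) := by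
  rw [InfiniteGalois.mem_range_algebraMap_iff_fixed]
  simp only [AlgEquiv.smul_def]

/-- **`O^×_v := (O^×_{K̄_v})^{G_v}` IS the norm-one part of `K_v`** (i.e. `O^×_{K_v}` embedded in `K̄_v`).
[cite: LANA2026Report, §3.9 p. 21] -/
theorem mem_unitInv_iff (u : unitGrp (val K₀)) :
    u ∈ unitInv (val K₀) (Gal K₀) ↔
      ((u : (AlgCl K₀)ˣ) : AlgCl K₀) ∈ Set.range (algebraMap K₀ (AlgCl K₀)) := by
  rw [← fixed_iff_mem_range, unitInv, mem_unitInvariants_iff]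
  constructor
  · intro h σ
    have hσ := congrArg (fun v : unitGrp (val K₀) => ((v : (AlgCl K₀)ˣ) : AlgCl K₀)) (h ⟨σ, trivial⟩)
    simpa only [unitGrp.coe_smul] using hσ
  · intro h σ
    exact Subtype.ext (Units.ext (by rw [unitGrp.coe_smul]; exact h σ))

end CharZero

end AlgCl

end IUTFork

end Summit.ABC

end
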